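import Summits.CriticalPhenomena.Ising3DConformalLimit.Theses.PerfectScreening
import Literature.Probability.LatticeModels.LatticeGreenPoisson
import Literature.Probability.LatticeModels.CriticalTwoPointLawDimension
import Literature.Probability.LatticeModels.CriticalTwoPointLower
import Literature.Probability.LatticeModels.HighDimPointwiseTriviality
import HarnessLib

/-!
# `SubharmonicOffOrigin` (crux stmt-CriticalPhenomena-1341): the MAXIMUM-PRINCIPLE TEST

Refuter file (cdisprove seat `refuter-cdisprove-stmt-CriticalPhenomena-1341-0`) for the crux
`SubH : ∀ x ≠ 0, 6·G(x) ≤ ∑ᵢ (G(x+eᵢ) + G(x−eᵢ))`, `G = criticalTwoPoint 3` (route `PerfectScreening`).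

`subharmonicOffOrigin_false_of_exists_gt` — the **global test**: if at ANY site
`3·(1 − G(e₀))·latticeGreen x < G x`, then SubH is false. Contrapositive of the maximum principle for
`u = G − 3(1−G(e₀))·latticeGreen`: under SubH, `u` is subharmonic on all of `ℤ³` (at `x ≠ 0` by SubH and
the lattice Poisson identity `Δ latticeGreen = −2δ₀` of `LatticeGreenPoisson.lean`; AT the origin
`Δu(0) = −6(1−G(e₀)) + 3(1−G(e₀))·2 = 0`) and `u → 0` at infinity, so `u ≤ 0`
(`IsZdSubharmonicOn.nonpos_of_tendsto_zero`). With `E_c = G(e₀) ≈ 0.3302022`,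
`3(1−E_c) = 2.0093934` and the exact values of `latticeGreen/2` this reads `G_c(1,1,0) ≤ 0.221801`,
`G_c(1,1,1) ≤ 0.175131`, `G_c(2,0,0) ≤ 0.172365`, … — decidable by Monte Carlo to 1e-5 and sensitive to
a failure of SubH ANYWHERE in `ℤ³`, not only at the measured sites.

No statement of the route is asserted positively. References: G. Lawler, *Intersections of random
walks* (1991), §1.4–1.5 [Lawler1991].
-/

noncomputable section

open MeasureTheory Filter Topology Finset Real
open Literature.Probability.LatticeModels

namespace Summit.CriticalPhenomena.Ising3DConformalLimit.SubharmonicOffOriginMaxPrinciple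

/-! ### The maximum-principle test for SubH -/

/-- All nearest-neighbour values of the critical two-point function agree: `G(±eᵢ) = G(e₀)`
(permutation and reflection symmetry). [folklore] -/
theorem criticalTwoPoint_unit (i : Fin 3) :
    criticalTwoPoint 3 (Pi.single i 1) = criticalTwoPoint 3 (Pi.single 0 1) ∧
    criticalTwoPoint 3 (-Pi.single i 1) = criticalTwoPoint 3 (Pi.single 0 1) := by
  have h := twoPointPlus_single_eq_single (d := 3) twoPointPlus_perm_invariant_holds
    (criticalBeta_nonneg 3) i 0 1
  refine ⟨h, ?_⟩
  rw [criticalTwoPoint_neg]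
  exact h

/-- The Laplacian of the critical two-point function at the origin is `−6(1 − G(e₀))`.
[folklore] -/
theorem latticeLaplacianZd_criticalTwoPoint_zero :
    latticeLaplacianZd (criticalTwoPoint 3) 0 = -(6 * (1 - criticalTwoPoint 3 (Pi.single 0 1))) := by
  rw [latticeLaplacianZd_def]
  simp only [zero_add, zero_sub, criticalTwoPoint_zero', Fin.sum_univ_three,
    (criticalTwoPoint_unit 0).2, (criticalTwoPoint_unit 1).1,
    (criticalTwoPoint_unit 1).2, (criticalTwoPoint_unit 2).1, (criticalTwoPoint_unit 2).2]
  ring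

/-- **THE MAXIMUM-PRINCIPLE TEST.** If the critical two-point function exceeds the screened
Coulomb potential `3(1 − G(e₀))·latticeGreen` at a single site, SubH fails: under SubH the function
`u = G − 3(1−G(e₀))·latticeGreen` is subharmonic on all of `ℤ³` (off the origin by SubH and the
Poisson identity; AT the origin `Δu(0) = −6(1−G(e₀)) + 3(1−G(e₀))·2 = 0`) and tends to `0` at
infinity, hence `u ≤ 0` everywhere (maximum principle at infinity,
`IsZdSubharmonicOn.nonpos_of_tendsto_zero`). [folklore] -/
theorem subharmonicOffOrigin_false_of_exists_gt
    (hex : ∃ x : Site 3,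
      3 * (1 - criticalTwoPoint 3 (Pi.single 0 1)) * latticeGreen x < criticalTwoPoint 3 x) :
    ¬ Summit.CriticalPhenomena.Ising3DConformalLimit.Theses.PerfectScreening.SubharmonicOffOrigin := by
  intro hSub
  obtain ⟨x₀, hx₀⟩ := hex
  set κ : ℝ := 3 * (1 - criticalTwoPoint 3 (Pi.single 0 1)) with hκ
  set u : Site 3 → ℝ := fun x => criticalTwoPoint 3 x - κ * latticeGreen x with hu
  -- `u` is subharmonic everywhere
  have hsub : IsZdSubharmonicOn u Set.univ := by
    intro x _
    have hΔ : latticeLaplacianZd u x =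
        latticeLaplacianZd (criticalTwoPoint 3) x - κ * latticeLaplacianZd latticeGreen x := by
      rw [hu, show (fun x => criticalTwoPoint 3 x - κ * latticeGreen x) =
        (criticalTwoPoint 3) - (fun x => κ * latticeGreen x) from rfl, latticeLaplacianZd_sub,
        latticeLaplacianZd_const_mul]
    rw [hΔ, latticeLaplacianZd_latticeGreen 3 le_rfl]
    by_cases hx : x = 0
    · subst hx
      rw [if_pos rfl, mul_one, latticeLaplacianZd_criticalTwoPoint_zero, hκ]
      ring_nf
      exact le_rfl
    · rw [if_neg hx, mul_zero, mul_zero, sub_zero]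
      have h := hSub x hx
      rw [latticeLaplacianZd_nonneg_iff]
      norm_num
      exact h
  -- `u → 0` at infinity
  have hlim : Tendsto u cofinite (𝓝 0) := by
    have h := criticalTwoPoint_tendsto_zero_cofinite.sub
      ((tendsto_latticeGreen_cofinite 3 le_rfl).const_mul κ)
    simpa [hu] using h
  have hle := hsub.nonpos_of_tendsto_zero (by norm_num) hlim x₀
  simp only [hu] at hle
  linarith

end Summit.CriticalPhenomena.Ising3DConformalLimit.SubharmonicOffOriginMaxPrinciple
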